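import Summits.RiemannHypothesis.RiemannHypothesis.Theorems.LiHeightLawLogRanges

/-!
# W-06 cycle 7 «DETECTION COST ATLAS» — the PLANTED LI SEQUENCE (model A), defs of record (rh-idea-4 g14)

(CA116) lane file (3a): ONE tree copy of rh-idea-4's C6⁷ objects, credit rh-idea-4 g14.  The declarations
`RhIdea4.G14.W06C67.{rho, rho', plantedLiTerm, plantedLi, normSq_one_sub_inv_rho, normSq_one_sub_inv_rho',
abs_plantedLiTerm_sub_four_le, liBlindDegree, BlindL}` are l.36–115 VERBATIM of
`pub/ideators/rh-idea-6/g15/c47b/PlantedLiBlind-rh-idea-6-g15.lean` sha16 11b4c4e6ae623134 · 340, themselves copied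
verbatim from rh-idea-4's Sketch `pub/ideators/rh-idea-4/c7/Sketch-W06c7-C6-LiJensenCost-rh-idea-4-g14-rev2.lean`
sha16 7c6ab868c603b986 (l.45–54, 57–81, 86–99, 105–107, 116–121).  Model A = the Li sequence of ζ
(`keiperLiCoeff`) plus the Li term of ONE planted off-line quadruple `{1/2 ± δ ± iγ}`; `BlindL` is the `blind_L`
half of rh-idea-4's `stub_li_cost`, proved in `Theorems/PlantedLiBlindness.lean` (rh-idea-6 g15).
READING (TEST 0): statements about a PLANTED sequence with a KNOWN off-line pair; nothing here bears on the truth of RH.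
-/

namespace RhIdea4.G14.W06C67

open Complex Literature.NumberTheory.LFunctions Literature.NumberTheory.DiophantineGeometry
open Summit.RiemannHypothesis.RiemannHypothesis.Theorems.LiTheory

noncomputable section


/-- The planted off-line zero `ρ = ½ + δ + iγ`. -/
def rho (γ δ : ℝ) : ℂ := ⟨1/2 + δ, γ⟩
/-- Its functional-equation partner `ρ′ = 1 − ρ̄ = ½ − δ + iγ`. -/
def rho' (γ δ : ℝ) : ℂ := ⟨1/2 - δ, γ⟩

/-- Li contribution of the planted quadruple `{ρ, ρ̄, ρ′, ρ̄′}`: `Σ (1 − (1 − 1/ρ)^n) = 4 − 2 Re[(1−1/ρ)^n + (1−1/ρ′)^n]`. -/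
def plantedLiTerm (γ δ : ℝ) (n : ℕ) : ℝ :=
  4 - 2 * ((1 - 1 / rho γ δ) ^ n + (1 - 1 / rho' γ δ) ^ n).re

/-- The planted Li sequence `λ_n^{pl} = λ_n(ζ) + plantedLiTerm` (LOCAL stand-in; g15 re-bases on rh-idea-2's defs). -/
def plantedLi (γ δ : ℝ) (n : ℕ) : ℝ := keiperLiCoeff n + plantedLiTerm γ δ n

/-- Exact modulus law of the decaying factor: `‖1 − 1/ρ‖² = ((δ−½)² + γ²)/((δ+½)² + γ²)` ( = `1 − 2δ/‖ρ‖²`). -/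
theorem normSq_one_sub_inv_rho (γ δ : ℝ) (h : (1/2 + δ) ^ 2 + γ ^ 2 ≠ 0) :
    Complex.normSq (1 - 1 / rho γ δ) = ((δ - 1/2) ^ 2 + γ ^ 2) / ((δ + 1/2) ^ 2 + γ ^ 2) := by
  have hρ : rho γ δ ≠ 0 := by
    intro h0
    have := congrArg Complex.normSq h0
    simp [rho, Complex.normSq_apply] at this
    apply h; nlinarith [this]
  have e : 1 - 1 / rho γ δ = (rho γ δ - 1) / rho γ δ := by field_simp
  rw [e, Complex.normSq_div]
  simp [rho, Complex.normSq_apply]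
  ring_nf

/-- Exact modulus law of the growing factor: `‖1 − 1/ρ′‖² = ((δ+½)² + γ²)/((δ−½)² + γ²)` ( = `1 + 2δ/‖ρ′‖²`). -/
theorem normSq_one_sub_inv_rho' (γ δ : ℝ) (h : (1/2 - δ) ^ 2 + γ ^ 2 ≠ 0) :
    Complex.normSq (1 - 1 / rho' γ δ) = ((δ + 1/2) ^ 2 + γ ^ 2) / ((δ - 1/2) ^ 2 + γ ^ 2) := by
  have hρ : rho' γ δ ≠ 0 := by
    intro h0
    have := congrArg Complex.normSq h0
    simp [rho', Complex.normSq_apply] at this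
    apply h; nlinarith [this]
  have e : 1 - 1 / rho' γ δ = (rho' γ δ - 1) / rho' γ δ := by field_simp
  rw [e, Complex.normSq_div]
  simp [rho', Complex.normSq_apply]
  ring_nf


/-- Two-sided ENVELOPE of the planted term (PROVED): `|plantedLiTerm − 4| ≤ 2(‖1−1/ρ‖ⁿ + ‖1−1/ρ′‖ⁿ)` — with the two
`normSq` laws this is `4 − 2(r₋ⁿ + r₊ⁿ) ≤ plantedLiTerm ≤ 4 + 2(r₋ⁿ + r₊ⁿ)`, `r₊² = 1 + 2δ/‖ρ′‖²`, `r₋² = 1 − 2δ/‖ρ‖²`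
(Brown's modulus-defect weight `liCoshWeight` of the tree, PART J of `LiHeightLawLogDefs`, is the worst case `δ = ½`). -/
theorem abs_plantedLiTerm_sub_four_le (γ δ : ℝ) (n : ℕ) :
    |plantedLiTerm γ δ n - 4| ≤ 2 * (‖1 - 1 / rho γ δ‖ ^ n + ‖1 - 1 / rho' γ δ‖ ^ n) := by
  unfold plantedLiTerm
  have h1 : |((1 - 1 / rho γ δ) ^ n + (1 - 1 / rho' γ δ) ^ n).re| ≤
      ‖(1 - 1 / rho γ δ) ^ n + (1 - 1 / rho' γ δ) ^ n‖ := Complex.abs_re_le_norm _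
  have h2 : ‖(1 - 1 / rho γ δ) ^ n + (1 - 1 / rho' γ δ) ^ n‖ ≤
      ‖1 - 1 / rho γ δ‖ ^ n + ‖1 - 1 / rho' γ δ‖ ^ n := by
    refine (norm_add_le _ _).trans ?_
    rw [norm_pow, norm_pow]
  rw [show 4 - 2 * ((1 - 1 / rho γ δ) ^ n + (1 - 1 / rho' γ δ) ^ n).re - 4 =
      -(2 * ((1 - 1 / rho γ δ) ^ n + (1 - 1 / rho' γ δ) ^ n).re) by ring, abs_neg, abs_mul,
    abs_of_pos (by norm_num : (0:ℝ) < 2)]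
  exact (mul_le_mul_of_nonneg_left h1 (by norm_num)).trans (mul_le_mul_of_nonneg_left h2 (by norm_num))


/-- BLIND-BELOW closed form (lower law): `b_L(γ,δ) = (γ²/δ)·(log(γ²/δ) − 2)` — below it `4cosh(nδ/γ²) − 4 < (n/2)log n − |liC1| n − error`. -/
def liBlindDegree (γ δ : ℝ) : ℝ :=
  γ ^ 2 / δ * (Real.log (γ ^ 2 / δ) - 2)


/-- `blind_L`: below `b_L(γ,δ)` (and above the tree law's threshold `n ≥ 900`) the planted Li sequence stays POSITIVE. -/
def BlindL : Prop :=
  ∀ ⦃T γ δ : ℝ⦄, 1000 ≤ T → RiemannHypothesisUpTo T → 100 ≤ γ → 0 < δ → δ < 1/2 →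
    liBlindDegree γ δ ≤ T ^ 2 →
    ∀ n : ℕ, 900 ≤ n → (n : ℝ) ≤ liBlindDegree γ δ → 0 < plantedLi γ δ n


end

end RhIdea4.G14.W06C67
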